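import Summits.BirchSwinnertonDyer.BirchSwinnertonDyer.Theorems.PrintCf2SplitBadTwoRestrictedSelmerCMSideConditions
import Summits.BirchSwinnertonDyer.BirchSwinnertonDyer.Theorems.PrintCf2SplitBadTwoCMPrimaryStructure
import Summits.BirchSwinnertonDyer.BirchSwinnertonDyer.Theorems.PrintCf2SplitBadTwoInertiaFixedTorsionSharp
import Summits.BirchSwinnertonDyer.BirchSwinnertonDyer.Theorems.PrintCf2SplitBadTwoRestrictedSelmerPairSkeleton
import Literature.NumberTheory.EllipticCurves.Castella2018.AnticyclotomicSelmerDualModuleFinite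
import Literature.NumberTheory.EllipticCurves.Agboola2007.RestrictedSelmerDualProofs
import Literature.NumberTheory.EllipticCurves.SubgroupSelmerCocycleCriteriaProofs
import Literature.NumberTheory.EllipticCurves.IwasawaTwistedCocycleProofs
import HarnessLib

/-!
# Crux `PrintCf2.SplitBadTwoRankOneOfFacts` (stmt-BirchSwinnertonDyer-20368), road α (v10.3 stub S3c) — `X_𝔮(K_∞, W*)` IS FINITELY
# GENERATED OVER `Λ`: the hypothesis `Module.Finite (IwasawaAlgebra 2) D.X` of S3c / LEAD's identities, DISCHARGED on every frame

Cell `bsd-print-cf2`, EXTRA WIDTH seat `bsd-line-cf2-p1-w4` g8 (prover-bsd-line-cf2-p1-w4-g8-0); `--supports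
stmt-BirchSwinnertonDyer-20368` (helper, Theses-free). HONEST FRAMING: nothing here closes the crux or a registered stub; BSD is
not proved by any of this; no summit statement is proved by this seat. No definition, no named fact, no `sorry`. UNCONDITIONAL.

WHAT. S3c (v9/v10.3 text) and every S3c₂-brick (p652120, p657357, p660647, …) carry `Module.Finite (IwasawaAlgebra 2) D.X` for a dual
datum `D : RestrictedDualData κ' W* v̄ γ'` of Agboola's restricted Selmer group, `W* = ↥((W.baseChange K).endEigenPrimaryTorsion 2 π r)`.
Greenberg (LNM 1716 §1 p. 60: "`X/𝔪X` is finite … Nakayama … This can actually be proved for any prime `p`, with no restriction on the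
reduction type") and the tree prove it for `E[p^∞]`-coefficients: `AcSelmer.finite_setOf_selmerAc_pTorsion_conjH1_eq` (Castella 2018 §2.1,
ANY curve / `p` / `ℤ_p`-line / place, PROVED) gives the finiteness of `Sel_𝔮^∅(K_∞, E[p^∞])[𝔪] = {s | p s = 0, conj_γ s = s}`, and LEAD g10's
`RestrictedDualData.module_finite_of_finite` is the dual Nakayama step for Agboola's module. This file transports along the CM SUMMAND:
* §1 (any elliptic `V/K`, `p`, `π ∈ End_K(V)`, `r`, normal `H ≤ Γ_K`): the map `ι_* : H¹(H, E[𝔮_r^∞]) → H¹(H, E[p^∞])` induced by the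
  inclusion `E[𝔮_r^∞] = endEigenPrimaryTorsion p π r ↪ E[p^∞]` (`resH1Hom id subtype`) commutes with restriction to subgroups
  (`resOfLe_comp_toPrimaryH1`) and with `conj_σ` (`conjH1_comp_toPrimaryH1`), hence maps `𝔖_𝔮(L, E[𝔮_r^∞])` into `𝔖_𝔮(L, E[p^∞])`
  (`toPrimaryH1_mem_restrictedSelmer`); and it is INJECTIVE as soon as `E[𝔮_r^∞]` has a `Γ_K`-stable COMPLEMENT `C'` in `E[p^∞]`
  (`toPrimaryH1_injective_of_compl`: a coboundary `h·n − n` with values in `C` splits along `E[p^∞] = C ⊕ C'`).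
* §2 `finite_setOf_restrictedSelmerZp_pTorsion_of_compl` — hence `𝔖_𝔮(K_∞, E[𝔮_r^∞])[𝔪]` is finite, and
  `RestrictedDualData.module_finite_of_compl` — EVERY dual datum of `𝔖_𝔮(K_∞, E[𝔮_r^∞])` is finitely generated over `Λ`.
* §3 ROAD α: on an S3c frame (`C • W = cm7^{(d)}` so `j = −3375`, `π² = π − 2` `K`-rational so `√−7 ∈ K`, `r² = r − 2`) the complement is
  the conjugate summand `endEigenPrimaryTorsion 2 π (1 − r)` (-w2 g7's `CMPrimes.exists_eigen_pair_two`: `C ⊓ C' = ⊥`, `C ⊔ C' = ⊤`), so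
  **`RestrictedDualData.module_finite_of_frame : Module.Finite (IwasawaAlgebra 2) D.X`** for EVERY `κ'`, `γ'` (topological generator),
  `v̄` and `D` — no `IsUnramifiedOutside`, no imaginary-quadratic hypothesis, no main conjecture.
presearch: Greenberg LNM 1716 §1 p. 60; Castella 2018 §2.1; Agboola 2007 §1 p. 2 ("the Iwasawa module … X_{𝔭*}(K*_∞, W*)") — all held;
assembly of tree theorems, no new fact.

References: [GreenbergLNM1716] §1 p. 60; [Castella2018] §2.1 Def. 2.2; [Agboola2007] §1 p. 2, §3; [Lang1990] Ch. 5 §1.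
-/

noncomputable section

open scoped Classical

set_option linter.dupNamespace false
set_option autoImplicit false

open NumberField IsDedekindDomain Field WeierstrassCurve
open Literature.NumberTheory.EllipticCurves.CocycleCriteria
open Literature.NumberTheory.EllipticCurves Literature.NumberTheory.EllipticCurves.GreenbergSelmer
open Literature.NumberTheory.EllipticCurves.Agboola2007
open Literature.NumberTheory.EllipticCurves.IwasawaAlgebra
open Literature.NumberTheory.EllipticCurves.IwasawaDual
open Literature.NumberTheory.GaloisRepresentations

universe u

namespace Summit.BirchSwinnertonDyer.BirchSwinnertonDyer.Theorems.PrintCf2.RestrictedSelmerPair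

/-! ## §1. The summand inclusion on `H¹`: naturality and injectivity -/

section Summand

variable {K : Type u} [Field K] [NumberField K] (V : WeierstrassCurve K) (p : ℕ) [Fact p.Prime]
  (π : V.endRing) (r : ℤ_[p]) (H : Subgroup (absoluteGaloisGroup K))

omit [NumberField K] in
/-- The inclusion `E[𝔮_r^∞] ↪ E[p^∞]` is `H`-equivariant (the action on the summand is the restricted one): the compatibility datum of
`resH1Hom`. [cite: Rubin1999, §2] -/
theorem subtype_smul_endEigenPrimaryTorsion (x : H) (m : ↥(V.endEigenPrimaryTorsion p π r)) :
    (V.endEigenPrimaryTorsion p π r).subtype (ContinuousMonoidHom.id H x • m) = x • (V.endEigenPrimaryTorsion p π r).subtype m :=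
  rfl

omit [NumberField K] in
/-- **`ι_*` commutes with restriction**: for `H' ≤ H`, `res_{H'} ∘ ι_*^H = ι_*^{H'} ∘ res_{H'}` (both are induced by the pair
`(H' ↪ H, E[𝔮_r^∞] ↪ E[p^∞])`). [cite: SerreGaloisCohomology1997, I §2.4] -/
theorem resOfLe_comp_toPrimaryH1 {H' : Subgroup (absoluteGaloisGroup K)} (hle : H' ≤ H) :
    (resOfLe (V.geomPrimaryTorsion p) hle).comp
        (resH1Hom (ContinuousMonoidHom.id H) (V.endEigenPrimaryTorsion p π r).subtype
          (subtype_smul_endEigenPrimaryTorsion V p π r H)) =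
      (resH1Hom (ContinuousMonoidHom.id H') (V.endEigenPrimaryTorsion p π r).subtype
          (subtype_smul_endEigenPrimaryTorsion V p π r H')).comp
        (resOfLe ↥(V.endEigenPrimaryTorsion p π r) hle) := by
  rw [Literature.NumberTheory.EllipticCurves.resOfLe, Literature.NumberTheory.EllipticCurves.resOfLe, resH1Hom_comp,
    resH1Hom_comp]
  exact resH1Hom_congr (by ext; rfl) (by ext; rfl) _ _

omit [NumberField K] in
/-- **`ι_*` commutes with `conj_σ`** for every `σ ∈ Γ_K` (the inclusion is `Γ_K`-equivariant; tree `conjH1_comp_resH1Hom_id`).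
[cite: NeukirchSchmidtWingberg2008, I §5] -/
theorem conjH1_comp_toPrimaryH1 (κ : ZpExtension K p) (σ : absoluteGaloisGroup K) :
    (conjH1 κ.kerSubgroup (V.geomPrimaryTorsion p) σ).comp
        (resH1Hom (ContinuousMonoidHom.id κ.kerSubgroup) (V.endEigenPrimaryTorsion p π r).subtype
          (subtype_smul_endEigenPrimaryTorsion V p π r κ.kerSubgroup)) =
      (resH1Hom (ContinuousMonoidHom.id κ.kerSubgroup) (V.endEigenPrimaryTorsion p π r).subtype
          (subtype_smul_endEigenPrimaryTorsion V p π r κ.kerSubgroup)).comp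
        (conjH1 κ.kerSubgroup ↥(V.endEigenPrimaryTorsion p π r) σ) :=
  conjH1_comp_resH1Hom_id κ (V.endEigenPrimaryTorsion p π r).subtype (fun _ _ ↦ rfl) _ σ

/-- **`ι_*` maps `𝔖_𝔮(K_∞, E[𝔮_r^∞])` into `𝔖_𝔮(K_∞, E[p^∞])`**: every restricted-Selmer condition is "a restriction of a conjugate
vanishes", which `ι_*` preserves (§1 naturality). [cite: Agboola2007, §3 (arXiv p0008:L18–20, L58–64)] -/
theorem toPrimaryH1_mem_restrictedSelmer (κ : ZpExtension K p) (𝔮 : HeightOneSpectrum (𝓞 K))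
    {c : subgroupH1 κ.kerSubgroup ↥(V.endEigenPrimaryTorsion p π r)} (hc : c ∈ restrictedSelmerZp κ ↥(V.endEigenPrimaryTorsion p π r) 𝔮) :
    resH1Hom (ContinuousMonoidHom.id κ.kerSubgroup) (V.endEigenPrimaryTorsion p π r).subtype
        (subtype_smul_endEigenPrimaryTorsion V p π r κ.kerSubgroup) c ∈
      restrictedSelmerZp κ (V.geomPrimaryTorsion p) 𝔮 := by
  set ι := resH1Hom (ContinuousMonoidHom.id κ.kerSubgroup) (V.endEigenPrimaryTorsion p π r).subtype
    (subtype_smul_endEigenPrimaryTorsion V p π r κ.kerSubgroup) with hι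
  obtain ⟨h1, h2, h3⟩ := (mem_restrictedSelmer_iff_resOfLe κ.kerSubgroup ↥(V.endEigenPrimaryTorsion p π r) p 𝔮 c).1 hc
  have hconj : ∀ σ : absoluteGaloisGroup K, conjH1 κ.kerSubgroup (V.geomPrimaryTorsion p) σ (ι c) =
      ι (conjH1 κ.kerSubgroup ↥(V.endEigenPrimaryTorsion p π r) σ c) := fun σ ↦ by
    rw [← AddMonoidHom.comp_apply, hι, conjH1_comp_toPrimaryH1, AddMonoidHom.comp_apply]
  have hres : ∀ {H' : Subgroup (absoluteGaloisGroup K)} (hle : H' ≤ κ.kerSubgroup)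
      (x : subgroupH1 κ.kerSubgroup ↥(V.endEigenPrimaryTorsion p π r)),
      resOfLe ↥(V.endEigenPrimaryTorsion p π r) hle x = 0 → resOfLe (V.geomPrimaryTorsion p) hle (ι x) = 0 := by
    intro H' hle x hx
    rw [← AddMonoidHom.comp_apply, hι, resOfLe_comp_toPrimaryH1, AddMonoidHom.comp_apply, hx, map_zero]
  refine (mem_restrictedSelmer_iff_resOfLe κ.kerSubgroup (V.geomPrimaryTorsion p) p 𝔮 _).2 ⟨fun w hw σ ↦ ?_, fun w σ ↦ ?_, fun σ ↦ ?_⟩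
  · rw [hconj]; exact hres _ _ (h1 w hw σ)
  · rw [hconj]; exact hres _ _ (h2 w σ)
  · rw [hconj]; exact hres _ _ (h3 σ)

omit [NumberField K] in
/-- **`ι_*` is injective when the summand has a `Γ_K`-stable complement** `C'` (`C ⊓ C' = ⊥`, `C ⊔ C' = E[p^∞]`): if `ι∘z = ∂n` with
`n = n₁ + n₂`, `n₁ ∈ C`, `n₂ ∈ C'`, then `h·n₂ − n₂ ∈ C ∩ C' = 0` for every `h ∈ H`, so `z = ∂n₁` already in `C`.
[cite: SerreGaloisCohomology1997, I §2.3 (cohomology of a direct sum)] -/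
theorem toPrimaryH1_injective_of_compl (C' : AddSubgroup (V.geomPrimaryTorsion p))
    (hC' : ∀ (σ : absoluteGaloisGroup K) (x : V.geomPrimaryTorsion p), x ∈ C' → σ • x ∈ C')
    (hinf : V.endEigenPrimaryTorsion p π r ⊓ C' = ⊥) (hsup : V.endEigenPrimaryTorsion p π r ⊔ C' = ⊤) :
    Function.Injective (resH1Hom (ContinuousMonoidHom.id H) (V.endEigenPrimaryTorsion p π r).subtype
      (subtype_smul_endEigenPrimaryTorsion V p π r H)) := by
  set C := V.endEigenPrimaryTorsion p π r with hCdef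
  refine (injective_iff_map_eq_zero _).2 fun x hx ↦ ?_
  obtain ⟨z, rfl⟩ := oneCocycleClass_surjective _ x
  obtain ⟨n, hn⟩ := (resH1Hom_oneCocycleClass_eq_zero_iff _ _ _ z).1 hx
  -- decompose `n = n₁ + n₂`
  have hn_mem : n ∈ C ⊔ C' := by rw [hsup]; exact AddSubgroup.mem_top n
  obtain ⟨n₁, hn₁, n₂, hn₂, hn12⟩ := AddSubgroup.mem_sup.1 hn_mem
  refine (oneCocycleClass_eq_zero_iff _ z).2 ⟨⟨n₁, hn₁⟩, fun g ↦ ?_⟩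
  have hg := hn g
  -- `(z g : E[p^∞]) = g•n − n`, split along the decomposition
  have hzC : ((z.1 g : C) : V.geomPrimaryTorsion p) ∈ C := (z.1 g).2
  have h1C : (g : absoluteGaloisGroup K) • n₁ - n₁ ∈ C :=
    C.sub_mem (smul_mem_endEigenPrimaryTorsion π r _ hn₁) hn₁
  have h2C' : (g : absoluteGaloisGroup K) • n₂ - n₂ ∈ C' := C'.sub_mem (hC' _ _ hn₂) hn₂
  have hsplit : ((z.1 g : C) : V.geomPrimaryTorsion p) =
      ((g : absoluteGaloisGroup K) • n₁ - n₁) + ((g : absoluteGaloisGroup K) • n₂ - n₂) := by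
    have : ((z.1 g : C) : V.geomPrimaryTorsion p) = (g : absoluteGaloisGroup K) • n - n := hg
    rw [this, ← hn12, smul_add]
    abel
  have h2C : (g : absoluteGaloisGroup K) • n₂ - n₂ ∈ C := by
    have : (g : absoluteGaloisGroup K) • n₂ - n₂ = ((z.1 g : C) : V.geomPrimaryTorsion p) -
        ((g : absoluteGaloisGroup K) • n₁ - n₁) := by rw [hsplit]; abel
    rw [this]
    exact C.sub_mem hzC h1C
  have h2zero : (g : absoluteGaloisGroup K) • n₂ - n₂ = 0 := by
    have hmem : (g : absoluteGaloisGroup K) • n₂ - n₂ ∈ C ⊓ C' := AddSubgroup.mem_inf.2 ⟨h2C, h2C'⟩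
    rw [hinf] at hmem
    exact (AddSubgroup.mem_bot).1 hmem
  apply Subtype.ext
  rw [hsplit, h2zero, add_zero]
  rfl

end Summand

/-! ## §2. `𝔖_𝔮(K_∞, E[𝔮_r^∞])[𝔪]` is finite; the dual is finitely generated -/

section ModuleFinite

variable {K : Type u} [Field K] [NumberField K] (V : WeierstrassCurve K) [V.IsElliptic] (p : ℕ) [Fact p.Prime]
  (π : V.endRing) (r : ℤ_[p]) (κ : ZpExtension K p) {γ : absoluteGaloisGroup K} (𝔮 : HeightOneSpectrum (𝓞 K))

/-- **`𝔖_𝔮(K_∞, E[𝔮_r^∞])[𝔪] = {s | p·s = 0, conj_γ s = s}` is FINITE** whenever `E[𝔮_r^∞]` has a `Γ_K`-stable complement in `E[p^∞]`: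
`ι_*` embeds it into `Sel_𝔮^∅(K_∞, E[p^∞])[𝔪]`, finite by the tree's `AcSelmer.finite_setOf_selmerAc_pTorsion_conjH1_eq` (Castella 2018
§2.1 / Greenberg §1 p. 60, PROVED for every curve, prime, `ℤ_p`-line and place).
[cite: GreenbergLNM1716, §1 p. 60 (after Conj. 1.3)] [cite: Castella2018, §2.1 Def. 2.2 (arXiv:1704.06608 p. 5)] -/
theorem finite_setOf_restrictedSelmerZp_pTorsion_of_compl (hγ : κ.IsTopGenerator γ)
    (C' : AddSubgroup (V.geomPrimaryTorsion p))
    (hC' : ∀ (σ : absoluteGaloisGroup K) (x : V.geomPrimaryTorsion p), x ∈ C' → σ • x ∈ C')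
    (hinf : V.endEigenPrimaryTorsion p π r ⊓ C' = ⊥) (hsup : V.endEigenPrimaryTorsion p π r ⊔ C' = ⊤) :
    Set.Finite {s : restrictedSelmerZp κ ↥(V.endEigenPrimaryTorsion p π r) 𝔮 |
      p • s = 0 ∧ conjRestricted κ ↥(V.endEigenPrimaryTorsion p π r) 𝔮 γ s = s} := by
  have hfin := Castella2018.AcSelmer.finite_setOf_selmerAc_pTorsion_conjH1_eq (W := V) (p := p) κ 𝔮 (S := ∅)
    Set.finite_empty hγ
  haveI := hfin.to_subtype
  set ι := resH1Hom (ContinuousMonoidHom.id κ.kerSubgroup) (V.endEigenPrimaryTorsion p π r).subtype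
    (subtype_smul_endEigenPrimaryTorsion V p π r κ.kerSubgroup) with hι
  have hinj : Function.Injective ι := toPrimaryH1_injective_of_compl V p π r κ.kerSubgroup C' hC' hinf hsup
  -- the comparison map into `Sel_𝔮^∅(K_∞, E[p^∞])[𝔪]`
  have hmemS : ∀ s : restrictedSelmerZp κ ↥(V.endEigenPrimaryTorsion p π r) 𝔮,
      ι (s : subgroupH1 κ.kerSubgroup ↥(V.endEigenPrimaryTorsion p π r)) ∈ Castella2018.AcSelmer.selmerAc V p κ 𝔮 ∅ :=
    fun s ↦ toPrimaryH1_mem_restrictedSelmer V p π r κ 𝔮 s.2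
  let f : {s : restrictedSelmerZp κ ↥(V.endEigenPrimaryTorsion p π r) 𝔮 |
        p • s = 0 ∧ conjRestricted κ ↥(V.endEigenPrimaryTorsion p π r) 𝔮 γ s = s} →
      {t : Castella2018.AcSelmer.selmerAc V p κ 𝔮 ∅ |
        p • t = 0 ∧ V.conjH1 p κ.kerSubgroup γ (t : V.subgroupH1 p κ.kerSubgroup) = t} :=
    fun s ↦ ⟨⟨ι (s.1 : subgroupH1 κ.kerSubgroup ↥(V.endEigenPrimaryTorsion p π r)), hmemS s.1⟩, by
      obtain ⟨hs1, hs2⟩ := s.2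
      refine ⟨Subtype.ext ?_, ?_⟩
      · show p • ι (s.1 : subgroupH1 κ.kerSubgroup ↥(V.endEigenPrimaryTorsion p π r)) = 0
        rw [← map_nsmul, ← AddSubgroupClass.coe_nsmul, hs1, ZeroMemClass.coe_zero, map_zero]
      · show conjH1 κ.kerSubgroup (V.geomPrimaryTorsion p) γ (ι _) = ι _
        rw [← AddMonoidHom.comp_apply, hι, conjH1_comp_toPrimaryH1, AddMonoidHom.comp_apply,
          ← coe_conjRestricted_apply, hs2]⟩
  have hf : Function.Injective f := by
    intro a b hab
    have h1 : ι (a.1 : subgroupH1 κ.kerSubgroup ↥(V.endEigenPrimaryTorsion p π r)) =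
        ι (b.1 : subgroupH1 κ.kerSubgroup ↥(V.endEigenPrimaryTorsion p π r)) :=
      congrArg (fun t : {t : Castella2018.AcSelmer.selmerAc V p κ 𝔮 ∅ |
        p • t = 0 ∧ V.conjH1 p κ.kerSubgroup γ (t : V.subgroupH1 p κ.kerSubgroup) = t} ↦
          ((t.1 : Castella2018.AcSelmer.selmerAc V p κ 𝔮 ∅) : V.subgroupH1 p κ.kerSubgroup)) hab
    exact Subtype.ext (Subtype.ext (hinj h1))
  exact Set.finite_coe_iff.mp (Finite.of_injective f hf)

/-- **`X_𝔮(K_∞, E[𝔮_r^∞])` IS FINITELY GENERATED over `Λ`** for every dual datum, whenever `E[𝔮_r^∞]` has a `Γ_K`-stable complement in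
`E[p^∞]` (any elliptic `V/K`, `p`, `K`-rational `π`, `r`, `ℤ_p`-line `κ` with topological generator `γ`, place `𝔮`): dual Nakayama
(`RestrictedDualData.module_finite_of_finite`, LEAD g10) on §2's finiteness. [cite: GreenbergLNM1716, §1 p. 60] [cite: Lang1990, Ch. 5 §1] -/
theorem module_finite_restrictedDual_of_compl (hγ : κ.IsTopGenerator γ)
    (C' : AddSubgroup (V.geomPrimaryTorsion p))
    (hC' : ∀ (σ : absoluteGaloisGroup K) (x : V.geomPrimaryTorsion p), x ∈ C' → σ • x ∈ C')
    (hinf : V.endEigenPrimaryTorsion p π r ⊓ C' = ⊥) (hsup : V.endEigenPrimaryTorsion p π r ⊔ C' = ⊤)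
    (D : RestrictedDualData κ ↥(V.endEigenPrimaryTorsion p π r) 𝔮 γ) :
    Module.Finite (IwasawaAlgebra p) D.X :=
  D.module_finite_of_finite (exists_pow_smul_endEigenPrimaryTorsion_eq_zero V p π r)
    (isOpen_stabilizer_endEigenPrimaryTorsion V p π r) hγ
    (finite_setOf_restrictedSelmerZp_pTorsion_of_compl V p π r κ 𝔮 hγ C' hC' hinf hsup)

end ModuleFinite

/-! ## §3. Road α: `Module.Finite (IwasawaAlgebra 2) D.X` on every S3c frame, unconditionally -/

section Frame

variable {K : Type} [Field K] [NumberField K]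

/-- **`X_{v̄}(K*_∞, W*)` is finitely generated over `Λ = ℤ₂⟦T⟧` on EVERY S3c frame.** Member `C • W = cm7^{(d)}` (`d ≠ 0`), `K` any number
field, `π ∈ End_K(E_K)` with `π² = π − 2`, `r² = r − 2`, `W* = E[𝔮_r^∞] = ↥((W.baseChange K).endEigenPrimaryTorsion 2 π r)`, ANY `ℤ₂`-line
`κ'` with topological generator `γ'`, ANY place `v̄`, ANY dual datum `D` of `𝔖_{v̄}(K*_∞, W*)`: **`Module.Finite (IwasawaAlgebra 2) D.X`** —
the hypothesis of S3c (v9/v10.3) and of every S3c₂-brick, DISCHARGED. The complement is the conjugate summand `E[𝔮̄^∞]` (root `1 − r`;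
-w2 g7's `CMPrimes.endEigenPrimaryTorsion_two_structure`, `j = −3375` from the twist, `√−7 ∈ K` from the `K`-rational `π`).
[cite: GreenbergLNM1716, §1 p. 60 (after Conj. 1.3)] [cite: Agboola2007, §1 p. 2 (arXiv p0004:L3–13)] -/
theorem module_finite_restrictedDual_of_frame {d : ℤ} (hd0 : d ≠ 0) (W : WeierstrassCurve ℚ) [W.IsElliptic]
    (C : VariableChange ℚ) (hC : C • W = cm7.quadraticTwist (d : ℚ))
    (π : (W.baseChange K).endRing) (hrel : (π : AddMonoid.End (W.baseChange K).geomPoints) * π = π - 2)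
    {r : ℤ_[2]} (hr : r * r = r - 2) (κ' : ZpExtension K 2) {γ' : absoluteGaloisGroup K} (hγ' : κ'.IsTopGenerator γ')
    (vbar : HeightOneSpectrum (𝓞 K))
    (D : RestrictedDualData κ' ↥((W.baseChange K).endEigenPrimaryTorsion 2 π r) vbar γ') :
    Module.Finite (IwasawaAlgebra 2) D.X := by
  haveI : (W.baseChange K).IsElliptic := by rw [baseChange]; infer_instance
  obtain ⟨θ, hθ⟩ := exists_sq_eq_neg_seven_of_frame_cmEndo hd0 W C hC π hrel
  obtain ⟨hinf, hsup, -⟩ :=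
    CMPrimes.endEigenPrimaryTorsion_two_structure W (AdditiveAtSeven.j_eq_of_smul_eq_cm7Twist hd0 W C hC) K hθ π hrel hr
  exact module_finite_restrictedDual_of_compl (W.baseChange K) 2 π r κ' vbar hγ'
    ((W.baseChange K).endEigenPrimaryTorsion 2 π (1 - r)) (fun σ x hx ↦ smul_mem_endEigenPrimaryTorsion π (1 - r) σ hx) hinf hsup D

end Frame

end Summit.BirchSwinnertonDyer.BirchSwinnertonDyer.Theorems.PrintCf2.RestrictedSelmerPair

end
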